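import Summits.AnomalousDissipation.AnomalousDissipation.Theorems.MomentParityMomentLadderSelection
import Mathlib.Algebra.Order.Floor.Semiring

/-!
# Crux `MomentParity.MomentLadder` (stmt-AnomalousDissipation-11463), line `Sketch`, one-trajectory currency —
# REAL-TIME LIMITS and the ORBIT DICTIONARY (converse machinery 4a/4)

§A From integer-time limits (Birkhoff) to the real-time `liminf` / `limsup` clauses of the crux's one-trajectory form:
`le_liminf_ratio` (the cumulative Taylor ratio), `limsup_ofReal_timeMean_le` (the unresolved-enstrophy tails, `ℝ≥0∞` form).
§B `orbit_dictionary`: for a phase-space datum with vanishing mean mode, the Galerkin orbit of `a = realTrigPoly (x̄)` is the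
trigonometric polynomial of the phase orbit, and its energy / enstrophy / truncated enstrophies are the coefficient energy /
band enstrophies of `Φ t x`. Folklore.
-/

set_option linter.dupNamespace false

noncomputable section

namespace Summit.AnomalousDissipation.AnomalousDissipation.Theorems.MomentLadder

open MeasureTheory Filter Topology Set Function UnitAddTorus intervalIntegral
open scoped ENNReal
open Literature.Analysis.FunctionSpaces Literature.Analysis.FluidPDE
open Summit.AnomalousDissipation.AnomalousDissipation.Theorems.QuarticGate.Negative
open Summit.AnomalousDissipation.AnomalousDissipation.Theorems.CubicParityLoud.Negative (T3 R3 H3 L2T3)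

/-! ## §A From integer-time limits to real-time `liminf` / `limsup` -/

section RealTime

/-- Growing-interval integrals of a nonnegative function are monotone on `[0, ∞)`. [folklore] -/
theorem integral_mono_of_nonneg_of_le {G : ℝ → ℝ} (hG0 : ∀ t, 0 ≤ G t)
    (hGi : ∀ a b, 0 ≤ a → 0 ≤ b → IntervalIntegrable G volume a b) {a b : ℝ} (ha : 0 ≤ a) (hab : a ≤ b) :
    ∫ t in (0 : ℝ)..a, G t ≤ ∫ t in (0 : ℝ)..b, G t :=
  integral_mono_interval le_rfl ha hab (Eventually.of_forall fun t => hG0 t) (hGi 0 b le_rfl (ha.trans hab))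

/-- **Integer-time means control real-time ratios from below.** Let `D, E ≥ 0` be locally integrable on `[0, ∞)` with
`D ≤ c E`, whose integer-time means converge, `n⁻¹∫₀ⁿ D → z`, `n⁻¹∫₀ⁿ E → e`, with `κ₀ e < z` (`0 ≤ κ₀`). Then
`κ₀ ≤ liminf_T (∫₀ᵀ D) / (∫₀ᵀ E)` over real `T → ∞` (sandwich between `⌊T⌋` and `⌊T⌋ + 1`; the denominators are
eventually positive because `∫ D > 0` forces `∫ E > 0`). [folklore] -/
theorem le_liminf_ratio {D E : ℝ → ℝ} (hD0 : ∀ t, 0 ≤ D t) (hE0 : ∀ t, 0 ≤ E t) {c : ℝ} (hc : 0 ≤ c)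
    (hDE : ∀ t, D t ≤ c * E t)
    (hDi : ∀ a b, 0 ≤ a → 0 ≤ b → IntervalIntegrable D volume a b)
    (hEi : ∀ a b, 0 ≤ a → 0 ≤ b → IntervalIntegrable E volume a b)
    {z e κ₀ : ℝ} (hκ₀ : 0 ≤ κ₀)
    (hz : Tendsto (fun n : ℕ => (n : ℝ)⁻¹ * ∫ t in (0 : ℝ)..(n : ℝ), D t) atTop (𝓝 z))
    (he : Tendsto (fun n : ℕ => (n : ℝ)⁻¹ * ∫ t in (0 : ℝ)..(n : ℝ), E t) atTop (𝓝 e)) (hlt : κ₀ * e < z) :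
    κ₀ ≤ liminf (fun T : ℝ => (∫ t in (0 : ℝ)..T, D t) / ∫ t in (0 : ℝ)..T, E t) atTop := by
  -- integrals dominate: `∫₀ᵀ D ≤ c ∫₀ᵀ E` for `T ≥ 0`
  have hdom : ∀ T, 0 ≤ T → ∫ t in (0 : ℝ)..T, D t ≤ c * ∫ t in (0 : ℝ)..T, E t := by
    intro T hT
    rw [← intervalIntegral.integral_const_mul]
    exact integral_mono_on hT (hDi 0 T le_rfl hT) ((hEi 0 T le_rfl hT).const_mul c) fun t _ => hDE t
  -- Step 1: eventually in `n`, `κ₀ ∫₀^{n+1} E < ∫₀ⁿ D`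
  obtain ⟨γ, hγ1, hγ2⟩ := exists_between hlt
  have hA : ∀ᶠ n : ℕ in atTop, γ < (n : ℝ)⁻¹ * ∫ t in (0 : ℝ)..(n : ℝ), D t := hz.eventually (lt_mem_nhds hγ2)
  have hB : Tendsto (fun n : ℕ => κ₀ * ((((n : ℝ) + 1) / (n : ℝ)) * (((n : ℝ) + 1)⁻¹ * ∫ t in (0 : ℝ)..((n : ℝ) + 1), E t)))
      atTop (𝓝 (κ₀ * (1 * e))) := by
    refine Tendsto.const_mul κ₀ (Tendsto.mul ?_ ?_)
    · have h1 : Tendsto (fun n : ℕ => 1 + (n : ℝ)⁻¹) atTop (𝓝 (1 + 0)) :=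
        tendsto_const_nhds.add (tendsto_inv_atTop_nhds_zero_nat (𝕜 := ℝ))
      rw [add_zero] at h1
      refine h1.congr' ?_
      filter_upwards [eventually_gt_atTop 0] with n hn
      have hn' : (n : ℝ) ≠ 0 := by exact_mod_cast hn.ne'
      field_simp
    · have h2 := he.comp (tendsto_add_atTop_nat 1)
      refine h2.congr fun n => ?_
      simp [Function.comp, Nat.cast_succ]
  rw [one_mul] at hB
  have hB' : ∀ᶠ n : ℕ in atTop, κ₀ * ((((n : ℝ) + 1) / (n : ℝ)) * (((n : ℝ) + 1)⁻¹ * ∫ t in (0 : ℝ)..((n : ℝ) + 1), E t)) < γ :=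
    hB.eventually (gt_mem_nhds hγ1)
  have hstep : ∀ᶠ n : ℕ in atTop, κ₀ * ∫ t in (0 : ℝ)..((n : ℝ) + 1), E t < ∫ t in (0 : ℝ)..(n : ℝ), D t := by
    filter_upwards [hA, hB', eventually_gt_atTop 0] with n hn1 hn2 hn0
    have hnR : (0 : ℝ) < n := by exact_mod_cast hn0
    have hn1R : (0 : ℝ) < (n : ℝ) + 1 := by positivity
    have e1 : κ₀ * ((((n : ℝ) + 1) / (n : ℝ)) * (((n : ℝ) + 1)⁻¹ * ∫ t in (0 : ℝ)..((n : ℝ) + 1), E t)) =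
        (n : ℝ)⁻¹ * (κ₀ * ∫ t in (0 : ℝ)..((n : ℝ) + 1), E t) := by
      field_simp
    rw [e1] at hn2
    have h3 : (n : ℝ)⁻¹ * (κ₀ * ∫ t in (0 : ℝ)..((n : ℝ) + 1), E t) < (n : ℝ)⁻¹ * ∫ t in (0 : ℝ)..(n : ℝ), D t :=
      hn2.trans hn1
    exact lt_of_mul_lt_mul_left h3 (inv_nonneg.2 hnR.le)
  -- Step 2: pass to real `T` through `n = ⌊T⌋`
  obtain ⟨n₁, hn₁⟩ := eventually_atTop.1 hstep
  have hev : ∀ᶠ T : ℝ in atTop, κ₀ < (∫ t in (0 : ℝ)..T, D t) / ∫ t in (0 : ℝ)..T, E t := by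
    filter_upwards [eventually_ge_atTop ((n₁ : ℝ) + 1)] with T hT
    have hT0 : 0 ≤ T := le_trans (by positivity) hT
    set n : ℕ := ⌊T⌋₊ with hn
    have hnT : (n : ℝ) ≤ T := Nat.floor_le hT0
    have hTn : T < (n : ℝ) + 1 := Nat.lt_floor_add_one T
    have hn₁n : n₁ ≤ n := Nat.le_floor (by linarith)
    have h1 := hn₁ n hn₁n
    have hDn : ∫ t in (0 : ℝ)..(n : ℝ), D t ≤ ∫ t in (0 : ℝ)..T, D t :=
      integral_mono_of_nonneg_of_le hD0 hDi (Nat.cast_nonneg n) hnT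
    have hEn : ∫ t in (0 : ℝ)..T, E t ≤ ∫ t in (0 : ℝ)..((n : ℝ) + 1), E t :=
      integral_mono_of_nonneg_of_le hE0 hEi hT0 hTn.le
    have hE0' : 0 ≤ ∫ t in (0 : ℝ)..T, E t := intervalIntegral.integral_nonneg hT0 fun t _ => hE0 t
    have key : κ₀ * ∫ t in (0 : ℝ)..T, E t < ∫ t in (0 : ℝ)..T, D t :=
      calc κ₀ * ∫ t in (0 : ℝ)..T, E t ≤ κ₀ * ∫ t in (0 : ℝ)..((n : ℝ) + 1), E t := mul_le_mul_of_nonneg_left hEn hκ₀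
        _ < ∫ t in (0 : ℝ)..(n : ℝ), D t := h1
        _ ≤ ∫ t in (0 : ℝ)..T, D t := hDn
    -- the denominator is positive
    have hDpos : 0 < ∫ t in (0 : ℝ)..T, D t := lt_of_le_of_lt (mul_nonneg hκ₀ hE0') key
    have hEpos : 0 < ∫ t in (0 : ℝ)..T, E t := by
      by_contra h
      have hEz : ∫ t in (0 : ℝ)..T, E t = 0 := le_antisymm (not_lt.1 h) hE0'
      have := hdom T hT0
      rw [hEz, mul_zero] at this
      exact absurd this (not_le.2 hDpos)
    exact (lt_div_iff₀ hEpos).2 key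
  -- boundedness above (`ratio ≤ c`) gives the coboundedness needed for `le_liminf_of_le`
  have hbdd : IsBoundedUnder (· ≤ ·) atTop (fun T : ℝ => (∫ t in (0 : ℝ)..T, D t) / ∫ t in (0 : ℝ)..T, E t) := by
    refine isBoundedUnder_of_eventually_le (a := c) ?_
    filter_upwards [eventually_ge_atTop (0 : ℝ)] with T hT
    have hE0' : 0 ≤ ∫ t in (0 : ℝ)..T, E t := intervalIntegral.integral_nonneg hT fun t _ => hE0 t
    rcases hE0'.eq_or_lt with hz0 | hpos
    · rw [← hz0, div_zero]; exact hc
    · rw [div_le_iff₀ hpos]; exact hdom T hT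
  exact le_liminf_of_le hbdd.isCoboundedUnder_flip (hev.mono fun T hT => hT.le)

/-- **Integer-time means control real-time means from above** (`G ≥ 0` locally integrable on `[0, ∞)`): if
`n⁻¹∫₀ⁿ G → τ` then `limsup_T ofReal (T⁻¹ ∫₀ᵀ G) ≤ ofReal τ` in `ℝ≥0∞`. [folklore] -/
theorem limsup_ofReal_timeMean_le {G : ℝ → ℝ} (hG0 : ∀ t, 0 ≤ G t)
    (hGi : ∀ a b, 0 ≤ a → 0 ≤ b → IntervalIntegrable G volume a b) {τ : ℝ}
    (hτ : Tendsto (fun n : ℕ => (n : ℝ)⁻¹ * ∫ t in (0 : ℝ)..(n : ℝ), G t) atTop (𝓝 τ)) :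
    limsup (fun T : ℝ => ENNReal.ofReal (T⁻¹ * ∫ t in (0 : ℝ)..T, G t)) atTop ≤ ENNReal.ofReal τ := by
  -- `((n+1)/n) A_{n+1} → τ`
  have hB : Tendsto (fun n : ℕ => (((n : ℝ) + 1) / (n : ℝ)) * (((n : ℝ) + 1)⁻¹ * ∫ t in (0 : ℝ)..((n : ℝ) + 1), G t))
      atTop (𝓝 (1 * τ)) := by
    refine Tendsto.mul ?_ ?_
    · have h1 : Tendsto (fun n : ℕ => 1 + (n : ℝ)⁻¹) atTop (𝓝 (1 + 0)) :=
        tendsto_const_nhds.add (tendsto_inv_atTop_nhds_zero_nat (𝕜 := ℝ))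
      rw [add_zero] at h1
      refine h1.congr' ?_
      filter_upwards [eventually_gt_atTop 0] with n hn
      have hn' : (n : ℝ) ≠ 0 := by exact_mod_cast hn.ne'
      field_simp
    · have h2 := hτ.comp (tendsto_add_atTop_nat 1)
      refine h2.congr fun n => ?_
      simp [Function.comp, Nat.cast_succ]
  rw [one_mul] at hB
  refine ENNReal.le_of_forall_pos_le_add fun δ hδ _ => ?_
  have hδR : (0 : ℝ) < δ := by exact_mod_cast hδ
  have hB' : ∀ᶠ n : ℕ in atTop, (((n : ℝ) + 1) / (n : ℝ)) * (((n : ℝ) + 1)⁻¹ * ∫ t in (0 : ℝ)..((n : ℝ) + 1), G t) < τ + δ :=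
    hB.eventually (gt_mem_nhds (by linarith))
  obtain ⟨n₁, hn₁⟩ := eventually_atTop.1 hB'
  refine limsup_le_of_le (h := ?_)
  filter_upwards [eventually_ge_atTop (max ((n₁ : ℝ) + 1) 1)] with T hT
  have hT1 : 1 ≤ T := (le_max_right _ _).trans hT
  have hT0 : 0 < T := zero_lt_one.trans_le hT1
  set n : ℕ := ⌊T⌋₊ with hn
  have hnT : (n : ℝ) ≤ T := Nat.floor_le hT0.le
  have hTn : T < (n : ℝ) + 1 := Nat.lt_floor_add_one T
  have hn1 : 1 ≤ n := Nat.le_floor (by simpa using hT1)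
  have hnpos : (0 : ℝ) < n := by exact_mod_cast hn1
  have hn₁n : n₁ ≤ n := Nat.le_floor (by linarith [le_max_left ((n₁ : ℝ) + 1) 1])
  have h1 := hn₁ n hn₁n
  have e1 : (((n : ℝ) + 1) / (n : ℝ)) * (((n : ℝ) + 1)⁻¹ * ∫ t in (0 : ℝ)..((n : ℝ) + 1), G t) =
      (n : ℝ)⁻¹ * ∫ t in (0 : ℝ)..((n : ℝ) + 1), G t := by
    field_simp
  rw [e1] at h1
  have hmono : ∫ t in (0 : ℝ)..T, G t ≤ ∫ t in (0 : ℝ)..((n : ℝ) + 1), G t :=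
    integral_mono_of_nonneg_of_le hG0 hGi hT0.le hTn.le
  have hI0 : 0 ≤ ∫ t in (0 : ℝ)..((n : ℝ) + 1), G t := intervalIntegral.integral_nonneg (by positivity) fun t _ => hG0 t
  have h2 : T⁻¹ * ∫ t in (0 : ℝ)..T, G t ≤ (n : ℝ)⁻¹ * ∫ t in (0 : ℝ)..((n : ℝ) + 1), G t :=
    calc T⁻¹ * ∫ t in (0 : ℝ)..T, G t ≤ T⁻¹ * ∫ t in (0 : ℝ)..((n : ℝ) + 1), G t :=
          mul_le_mul_of_nonneg_left hmono (inv_nonneg.2 hT0.le)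
      _ ≤ (n : ℝ)⁻¹ * ∫ t in (0 : ℝ)..((n : ℝ) + 1), G t :=
          mul_le_mul_of_nonneg_right (by rw [inv_le_inv₀ hT0 hnpos]; exact hnT) hI0
  calc ENNReal.ofReal (T⁻¹ * ∫ t in (0 : ℝ)..T, G t) ≤ ENNReal.ofReal (τ + δ) := ENNReal.ofReal_le_ofReal (h2.trans h1.le)
    _ ≤ ENNReal.ofReal τ + ENNReal.ofReal δ := ENNReal.ofReal_add_le
    _ = ENNReal.ofReal τ + δ := by rw [ENNReal.ofReal_coe_nnreal]

/-- **Deliverable (registered): real-time means from integer-time means, `ℝ≥0∞` form** (restates `limsup_ofReal_timeMean_le`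
in the clause order used by the converse). [folklore] -/
theorem timeMean_limsup_ofReal_le :
    ∀ (G : ℝ → ℝ) (τ : ℝ), (∀ t, 0 ≤ G t) → (∀ a b, 0 ≤ a → 0 ≤ b → IntervalIntegrable G volume a b) →
      Tendsto (fun n : ℕ => (n : ℝ)⁻¹ * ∫ t in (0 : ℝ)..(n : ℝ), G t) atTop (𝓝 τ) →
      limsup (fun T : ℝ => ENNReal.ofReal (T⁻¹ * ∫ t in (0 : ℝ)..T, G t)) atTop ≤ ENNReal.ofReal τ :=
  fun _ _ hG0 hGi hτ => limsup_ofReal_timeMean_le hG0 hGi hτ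

end RealTime

/-! ## §B The orbit of a phase-space datum, in the currency of the crux -/

section Orbit

variable {ν : ℝ} {f : T3 → R3} {N : ℕ}

/-- **Orbit identities.** For a phase-space datum `x` with vanishing mean mode, the field `a = realTrigPoly (x̄)` is a
mean-zero Galerkin mode of order `N`, its Galerkin orbit is the real trigonometric polynomial of the phase orbit
`Φ t x`, and the orbit's energy / enstrophy / truncated enstrophies are the coefficient energy / band enstrophies of
`Φ t x`. [folklore] -/
theorem orbit_dictionary (x : ↥(galerkinSubspace (Torus.freqBall (d := Fin 3) N)))
    (hx0 : (x : ↥(Torus.freqBall (d := Fin 3) N) → EuclideanSpace ℂ (Fin 3)) ⟨0, Torus.zero_mem_freqBall N⟩ = 0) :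
    IsGalerkinMode N (Torus.realTrigPoly (Torus.freqBall N) (Torus.coeffExt (Torus.freqBall N)
        (x : ↥(Torus.freqBall (d := Fin 3) N) → EuclideanSpace ℂ (Fin 3)))) ∧
    Torus.HasZeroMean (Torus.realTrigPoly (Torus.freqBall N) (Torus.coeffExt (Torus.freqBall N)
        (x : ↥(Torus.freqBall (d := Fin 3) N) → EuclideanSpace ℂ (Fin 3)))) ∧
    (∀ t, (∫ y, ‖Torus.galerkinFlow ν f N t (Torus.realTrigPoly (Torus.freqBall N) (Torus.coeffExt (Torus.freqBall N)
        (x : ↥(Torus.freqBall (d := Fin 3) N) → EuclideanSpace ℂ (Fin 3)))) y‖ ^ 2) =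
      ∑ k ∈ Torus.freqBall N, ‖Torus.coeffExt (Torus.freqBall N)
        ((galerkinPhaseFlow ν (fourierRestrict (Torus.freqBall N) f) t x :
          ↥(galerkinSubspace (Torus.freqBall (d := Fin 3) N))) :
            ↥(Torus.freqBall (d := Fin 3) N) → EuclideanSpace ℂ (Fin 3)) k‖ ^ 2) ∧
    (∀ (K : ℕ) (t : ℝ), Torus.eGradNormSq (Torus.fourierTruncate K (Torus.galerkinFlow ν f N t
        (Torus.realTrigPoly (Torus.freqBall N) (Torus.coeffExt (Torus.freqBall N)
          (x : ↥(Torus.freqBall (d := Fin 3) N) → EuclideanSpace ℂ (Fin 3)))))) =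
      ENNReal.ofReal (4 * Real.pi ^ 2 * ∑ k ∈ Torus.freqBall K, Torus.freqNormSq k * ‖Torus.coeffExt (Torus.freqBall N)
        ((galerkinPhaseFlow ν (fourierRestrict (Torus.freqBall N) f) t x :
          ↥(galerkinSubspace (Torus.freqBall (d := Fin 3) N))) :
            ↥(Torus.freqBall (d := Fin 3) N) → EuclideanSpace ℂ (Fin 3)) k‖ ^ 2)) ∧
    (∀ t, Torus.eGradNormSq (Torus.galerkinFlow ν f N t
        (Torus.realTrigPoly (Torus.freqBall N) (Torus.coeffExt (Torus.freqBall N)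
          (x : ↥(Torus.freqBall (d := Fin 3) N) → EuclideanSpace ℂ (Fin 3))))) =
      ENNReal.ofReal (4 * Real.pi ^ 2 * ∑ k ∈ Torus.freqBall N, Torus.freqNormSq k * ‖Torus.coeffExt (Torus.freqBall N)
        ((galerkinPhaseFlow ν (fourierRestrict (Torus.freqBall N) f) t x :
          ↥(galerkinSubspace (Torus.freqBall (d := Fin 3) N))) :
            ↥(Torus.freqBall (d := Fin 3) N) → EuclideanSpace ℂ (Fin 3)) k‖ ^ 2)) := by
  have hS : ∀ k ∈ Torus.freqBall (d := Fin 3) N, -k ∈ Torus.freqBall N := Torus.neg_mem_freqBall_of_mem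
  set a : T3 → R3 := Torus.realTrigPoly (Torus.freqBall N) (Torus.coeffExt (Torus.freqBall N)
    (x : ↥(Torus.freqBall (d := Fin 3) N) → EuclideanSpace ℂ (Fin 3))) with ha_def
  have ha : IsGalerkinMode N a := isGalerkinMode_realTrigPoly_coeffExt x.2
  -- mean zero, through the membership of the `L²` class in `H`
  have ha0 : Torus.HasZeroMean a := by
    have hmem := (MomentParity.toLp_realTrigPoly_mem_energySpace x.2 hx0).1
    have h1 := Torus.integral_eq_zero_of_mem_energySpace hmem
    have hae := MemLp.coeFn_toLp (Torus.memLp_realTrigPoly (Torus.freqBall N) (Torus.coeffExt (Torus.freqBall N)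
      (x : ↥(Torus.freqBall (d := Fin 3) N) → EuclideanSpace ℂ (Fin 3))) 2)
    show ∫ y, a y = 0
    rw [← h1]
    exact (integral_congr_ae hae).symm
  -- the orbit
  have hres : fourierRestrict (Torus.freqBall N) a = (x : ↥(Torus.freqBall (d := Fin 3) N) → EuclideanSpace ℂ (Fin 3)) :=
    fourierRestrict_realTrigPoly_coeffExt hS x.2.1
  have hflow : ∀ t, Torus.galerkinFlow ν f N t a = Torus.realTrigPoly (Torus.freqBall N) (Torus.coeffExt (Torus.freqBall N)
      ((galerkinPhaseFlow ν (fourierRestrict (Torus.freqBall N) f) t x :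
        ↥(galerkinSubspace (Torus.freqBall (d := Fin 3) N))) :
          ↥(Torus.freqBall (d := Fin 3) N) → EuclideanSpace ℂ (Fin 3))) := by
    intro t
    rw [ha.galerkinFlow_eq t, hres, coe_galerkinPhaseFlow]
  have hconj : ∀ t, Torus.IsConjSymm (Torus.coeffExt (Torus.freqBall N)
      ((galerkinPhaseFlow ν (fourierRestrict (Torus.freqBall N) f) t x :
        ↥(galerkinSubspace (Torus.freqBall (d := Fin 3) N))) :
          ↥(Torus.freqBall (d := Fin 3) N) → EuclideanSpace ℂ (Fin 3))) := fun t =>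
    (galerkinPhaseFlow ν (fourierRestrict (Torus.freqBall N) f) t x).2.1.isConjSymm_coeffExt hS
  refine ⟨ha, ha0, fun t => ?_, fun K t => ?_, fun t => ?_⟩
  · rw [hflow t, Torus.integral_norm_sq_realTrigPoly hS (hconj t)]
  · have hint : Integrable (Torus.realTrigPoly (Torus.freqBall N) (Torus.coeffExt (Torus.freqBall N)
        ((galerkinPhaseFlow ν (fourierRestrict (Torus.freqBall N) f) t x :
          ↥(galerkinSubspace (Torus.freqBall (d := Fin 3) N))) :
            ↥(Torus.freqBall (d := Fin 3) N) → EuclideanSpace ℂ (Fin 3)))) volume :=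
      (Torus.memLp_realTrigPoly (Torus.freqBall N) _ 2).integrable one_le_two
    rw [hflow t, Torus.fourierTruncate_eq, Torus.eGradNormSq_realTrigPoly Torus.neg_mem_freqBall_of_mem
      (Torus.isConjSymm_mFourierCoeff hint)]
    refine congrArg ENNReal.ofReal (congrArg (fun s => 4 * Real.pi ^ 2 * s) (Finset.sum_congr rfl fun k _ => ?_))
    rw [Torus.mFourierCoeff_realTrigPoly hS (hconj t) k]
    by_cases hk : k ∈ Torus.freqBall N
    · rw [if_pos hk]
    · rw [if_neg hk, Torus.coeffExt_of_not_mem _ hk]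
  · rw [hflow t, Torus.eGradNormSq_realTrigPoly hS (hconj t)]

end Orbit

end Summit.AnomalousDissipation.AnomalousDissipation.Theorems.MomentLadder

end
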